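/-
Copyright (c) 2026 the pub-hodgecm-mathlib formalisation cell (harness21).  Prover seat hodgecm-mathlib-K2Liu-p11 (g2), Track B «K2-LIT»,
#184♮ = hLiu418 = `stmt-HodgeConjecture-24832`; A7-val road (σ) «null-cone multiplicity one» (K2Liu-p09 (g6) memo 0ec4b1215f8a4fcc §3 V2),
LEAD F0P6-plan (g14) RULING «M-158d» (1) «V2 `K2LiuNullConeSupport` = K2Liu-p11 (g2)»; file V2b = THE TOPOLOGICAL LETTERS + (N), (N′).
THEOREMS ONLY (no `def`, no `instance`, no notation, no named-fact hypothesis, no `sorry`).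
-/
import Literature.NumberTheory.Automorphic.LocalPiModulationInvariantFunctional           -- ★ `piPrimePowBall` letters, `SchwartzBruhat`, conductor letters
import Summits.HodgeConjecture.HodgeConjecture.Theorems.K2LiuInvariantFunctionalFiniteAveraging  -- ★ (this seat) V2a: the algebraic core
import Mathlib.Topology.Algebra.OpenSubgroup
import HarnessLib

/-!
# Crux `HLiu418`, A7-val (σ), V2b: a functional invariant under the characters `ψ(⟨q(·), η⟩)` kills every test vector supported off the
# null cone `{q = 0}`

Cell `hodgecm-mathlib`, crux item hLiu418 = `stmt-HodgeConjecture-24832` (helper lane `--supports`, count-neutral).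

GENERIC setting (consumer: the Schrödinger model at a finite place, `X = 𝒮`-carrier `V′_v^{⊕2}`, `q = ` the Gram map `Q` in `Herm₂(E_v) ≅ F_v^ι`
coordinates, `η ↦ ψ_v(tr(η·Q))` the action of `N_Δ`, `{q = 0}` the null cone `𝒩`): `F` a non-archimedean local field, `ι` finite,
`ψ : AddChar F Circle` with conductor exponent `m`, `X` a topological space, `q : X → (ι → F)` continuous, characters `e η x = ψ(η ⬝ᵥ q x)`.
* §1 valuation letters: a non-zero `y : F` escapes some ball `𝔭^k`; compact subsets of `F^ι` lie in some `(𝔭^{−R})^ι` (★ `piPrimePowBall`);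
* §2 `exists_small_lattice` — «`L′` small»: `∃ N′`, every `η ∈ (𝔭^{N′})^ι` has `ψ(η ⬝ᵥ q x) = 1` on the support of a compactly supported `Φ`;
* §3 `exists_large_lattice` — «`L` large»: `∃ N`, at every point of the support of a locally constant compactly supported `Φ` with
  `supp Φ ∩ {q = 0} = ∅` some `η ∈ (𝔭^{N})^ι` has `ψ(η ⬝ᵥ q x) ≠ 1` (★ `exists_mem_primePowBall_addChar_mul_ne_one` + compactness);
* §4 the lattices as additive subgroups, `(𝔭^{N′})^ι` of FINITE INDEX in `(𝔭^{N})^ι` (open subgroup of a compact group);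
* §5 **`nullCone_support`** = (N) of V2: for ANY `ℂ`-linear `T` on a space of functions `V ↪ (X → ℂ)` with multiplication operators
  `M η` (`coe (M η Φ) x = ψ(η ⬝ᵥ q x) · coe Φ x`) and `T ∘ M η = T` for all `η`: `coe Φ` locally constant, compactly supported and supported
  off `{q = 0}` ⇒ **`T Φ = 0`** (★ V2a `apply_eq_zero_of_invariant`); `nullCone_support_schwartzBruhat` (`V = 𝒮(X)`), and (N′)
  `apply_eq_zero_of_eqOn_nullCone` (`coe Φ = 0` on `{q = 0}` suffices).  (N″) — restriction ONTO `C_c^∞(𝒩)` — is needed by V5 beyond the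
  factorisation and is typed separately (V2c `K2LiuTDRestrictionOnto`, the extension operator `C_c^∞(𝒩) → 𝒮(X)`);
* §6 THE CONSUMER'S CURRENCY (K2Liu-p09 (g6) (q1)(q2)): `ψ.IsContinuousNontrivial`, `T : (X → ℂ) →ₗ[ℂ] ℂ` with the invariance asked only
  on `𝒮(X)` — `nullCone_support_fun`, `apply_eq_zero_of_eqOn_nullCone_fun`, `apply_eq_of_eqOn_nullCone_fun`.
References: [BernsteinZelevinsky1976, §1.1–1.5]; [KudlaRallis1990, §2]; [WeilBNT1967, Ch. II §5].
HONEST LABEL: HC_CM is proved only modulo the 7 printed citations (2 remaining named inputs: hLiu418 = stmt-HodgeConjecture-24832,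
h413 = stmt-HodgeConjecture-24833) until rung 0 closes; count-neutral helper, closes no socket.
-/

set_option autoImplicit false
set_option linter.dupNamespace false

noncomputable section

open Set Filter NNReal
open scoped Topology

namespace Summit.HodgeConjecture.HodgeConjecture.Cruxes.HLiu418.K2LiuNullConeSupport

open Literature.NumberTheory.Automorphic
open Summit.HodgeConjecture.HodgeConjecture.Cruxes.HLiu418.K2LiuInvariantFunctionalFiniteAveraging

variable {F : Type*} [Field F] [ValuativeRel F] [TopologicalSpace F] [IsNonarchimedeanLocalField F]
variable {ι : Type*} [Fintype ι]
variable {X : Type*} [TopologicalSpace X]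

/-! ## §1  Valuation letters -/

/-- A non-zero element escapes some ball: `y ≠ 0 ⇒ ∃ k, y ∉ 𝔭^k` (namely `k = v(y) + 1`). [WeilBNT1967, Ch. II §5] -/
theorem exists_notMem_primePowBall {y : F} (hy : y ≠ 0) : ∃ k : ℤ, y ∉ primePowBall F k := by
  obtain ⟨k, hk⟩ := exists_normAbs_eq_inv_zpow hy
  refine ⟨k + 1, fun h => ?_⟩
  rw [mem_primePowBall_iff, hk] at h
  exact absurd h (not_le.mpr (zpow_right_strictAnti₀ inv_residueFieldCard_pos inv_residueFieldCard_lt_one (lt_add_one k)))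

/-- The same with the target exponent written as `m − n`: `y ≠ 0 ⇒ ∃ n, y ∉ 𝔭^{m−n}`. [WeilBNT1967, Ch. II §5] -/
theorem exists_notMem_primePowBall_sub (m : ℤ) {y : F} (hy : y ≠ 0) : ∃ n : ℤ, y ∉ primePowBall F (m - n) := by
  obtain ⟨k, hk⟩ := exists_notMem_primePowBall hy
  exact ⟨m - k, by rwa [sub_sub_cancel]⟩

/-- **A COMPACT SUBSET OF `F^ι` IS VALUATION-BOUNDED**: `K ⊆ (𝔭^{−R})^ι` for some `R : ℕ`. [WeilBNT1967, Ch. II §5] -/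
theorem exists_subset_piPrimePowBall_of_isCompact {K : Set (ι → F)} (hK : IsCompact K) :
    ∃ R : ℕ, K ⊆ piPrimePowBall F ι (-(R : ℤ)) := by
  have hcover : K ⊆ ⋃ R : ℕ, piPrimePowBall F ι (-(R : ℤ)) := fun x _ =>
    mem_iUnion.2 (exists_mem_piPrimePowBall x)
  have hdir : Directed (· ⊆ ·) fun R : ℕ => piPrimePowBall F ι (-(R : ℤ)) := by
    intro a b
    refine ⟨max a b, piPrimePowBall_antitone ?_, piPrimePowBall_antitone ?_⟩
    · exact neg_le_neg (Nat.cast_le.mpr (le_max_left a b))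
    · exact neg_le_neg (Nat.cast_le.mpr (le_max_right a b))
  exact hK.elim_directed_cover _ (fun R => isOpen_piPrimePowBall _) hcover hdir

/-! ## §2  «`L′` small»: the characters are trivial on the support for `η` deep enough -/

/-- **`L′` SMALL.**  For `q : X → F^ι` continuous and `Φ : X → ℂ` compactly supported: `∃ N′`, `ψ(η ⬝ᵥ q x) = 1` for all `η ∈ (𝔭^{N′})^ι` and
all `x` with `Φ x ≠ 0` (`q(supp Φ)` is compact, hence in `(𝔭^{−R})^ι`; take `N′ = m + R`, conductor of `ψ`). [BernsteinZelevinsky1976, §1.3] -/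
theorem exists_small_lattice {ψ : AddChar F Circle} {m : ℤ} (hm : ψ.HasConductorExp m) {q : X → ι → F} (hq : Continuous q)
    {Φ : X → ℂ} (hΦ : HasCompactSupport Φ) :
    ∃ N' : ℤ, ∀ η ∈ piPrimePowBall F ι N', ∀ x : X, Φ x ≠ 0 → ψ (η ⬝ᵥ q x) = 1 := by
  obtain ⟨R, hR⟩ := exists_subset_piPrimePowBall_of_isCompact (hΦ.isCompact.image hq)
  refine ⟨m + R, fun η hη x hx => hm.1 _ ?_⟩
  have hxK : q x ∈ piPrimePowBall F ι (-(R : ℤ)) := hR ⟨x, subset_tsupport _ hx, rfl⟩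
  have h := dotProduct_mem_primePowBall hη hxK
  rwa [show m + R + (-(R : ℤ)) = m by ring] at h

/-! ## §3  «`L` large»: off the null cone some character of the lattice is non-trivial -/

/-- **`L` LARGE.**  For `q` continuous and `Φ` locally constant, compactly supported, with `supp Φ ∩ {q = 0} = ∅`: `∃ N`, for every `x`
with `Φ x ≠ 0` some `η ∈ (𝔭^{N})^ι` has `ψ(η ⬝ᵥ q x) ≠ 1` (the support is compact, `q ≠ 0` on it, so one coordinate of `q x` escapes a
uniform ball; ★ `exists_mem_primePowBall_addChar_mul_ne_one` on that coordinate). [BernsteinZelevinsky1976, §1.3; KudlaRallis1990, §2] -/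
theorem exists_large_lattice {ψ : AddChar F Circle} {m : ℤ} (hm : ψ.HasConductorExp m) {q : X → ι → F} (hq : Continuous q)
    {Φ : X → ℂ} (hΦl : IsLocallyConstant Φ) (hΦc : HasCompactSupport Φ) (h0 : ∀ x : X, Φ x ≠ 0 → q x ≠ 0) :
    ∃ N : ℤ, ∀ x : X, Φ x ≠ 0 → ∃ η ∈ piPrimePowBall F ι N, ψ (η ⬝ᵥ q x) ≠ 1 := by
  classical
  -- the support is closed (locally constant) and compact
  have hS : IsClosed {x : X | Φ x ≠ 0} := by
    have h : {x : X | Φ x ≠ 0} = (Φ ⁻¹' {0})ᶜ := by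
      ext x
      simp
    rw [h]
    exact (hΦl.isOpen_fiber 0).isClosed_compl
  have hSc : IsCompact {x : X | Φ x ≠ 0} := hΦc.isCompact.of_isClosed_subset hS fun x hx => subset_tsupport _ hx
  have hK : IsCompact (q '' {x : X | Φ x ≠ 0}) := hSc.image hq
  -- open cover of the image by «coordinate `i` escapes `𝔭^{m−n}`»
  set U : ι × ℤ → Set (ι → F) := fun p => {z | z p.1 ∉ primePowBall F (m - p.2)} with hU
  have hUo : ∀ p, IsOpen (U p) := fun p =>
    ((isClosed_primePowBall (m - p.2)).preimage (continuous_apply p.1)).isOpen_compl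
  have hcov : q '' {x : X | Φ x ≠ 0} ⊆ ⋃ p, U p := by
    rintro z ⟨x, hx, rfl⟩
    have hz : q x ≠ 0 := h0 x hx
    obtain ⟨i, hi⟩ : ∃ i, q x i ≠ 0 := by
      by_contra h
      push Not at h
      exact hz (funext h)
    obtain ⟨n, hn⟩ := exists_notMem_primePowBall_sub m hi
    exact mem_iUnion.2 ⟨(i, n), hn⟩
  obtain ⟨t, ht⟩ := hK.elim_finite_subcover U hUo hcov
  refine ⟨-(∑ p ∈ t, |p.2|), fun x hx => ?_⟩
  obtain ⟨p, hp, hzp⟩ : ∃ p ∈ t, q x ∈ U p := by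
    have h := ht ⟨x, hx, rfl⟩
    simp only [mem_iUnion, exists_prop] at h
    exact h
  obtain ⟨x₀, hx₀, hne⟩ := exists_mem_primePowBall_addChar_mul_ne_one hm (n := p.2) hzp
  have hle : -(∑ p' ∈ t, |p'.2|) ≤ p.2 := by
    have h1 : |p.2| ≤ ∑ p' ∈ t, |p'.2| := Finset.single_le_sum (fun p' _ => abs_nonneg p'.2) hp
    have h2 : -|p.2| ≤ p.2 := neg_abs_le p.2
    linarith
  refine ⟨Pi.single p.1 x₀, piPrimePowBall_antitone hle (single_mem_piPrimePowBall p.1 hx₀), ?_⟩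
  rwa [single_dotProduct]

/-! ## §4  The lattices `(𝔭^N)^ι` as additive subgroups; finite index -/

/-- `(𝔭^{N′})^ι` has finite index in `(𝔭^{N})^ι` for `N ≤ N′` — packaged for ★ V2a: for the additive subgroups `L′ ≤ L` of `F^ι` with
carriers `piPrimePowBall F ι N′ ⊆ piPrimePowBall F ι N`, `L′.addSubgroupOf L` has finite index (open subgroup of a compact group).
[WeilBNT1967, Ch. II §5] -/
theorem finiteIndex_of_carrier_eq {L L' : AddSubgroup (ι → F)} {N N' : ℤ} (hL : (L : Set (ι → F)) = piPrimePowBall F ι N)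
    (hL' : (L' : Set (ι → F)) = piPrimePowBall F ι N') (hle : L' ≤ L) : (L'.addSubgroupOf L).FiniteIndex := by
  have _ := hle
  haveI : CompactSpace L := isCompact_iff_compactSpace.mp (by rw [hL]; exact isCompact_piPrimePowBall N)
  have hopen : IsOpen ((L'.addSubgroupOf L : AddSubgroup L) : Set L) := by
    have h : ((L'.addSubgroupOf L : AddSubgroup L) : Set L) = Subtype.val ⁻¹' (L' : Set (ι → F)) := by
      ext x
      simp [AddSubgroup.mem_addSubgroupOf]
    rw [h, hL']
    exact (isOpen_piPrimePowBall N').preimage continuous_subtype_val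
  haveI : Finite (L ⧸ L'.addSubgroupOf L) := AddSubgroup.quotient_finite_of_isOpen _ hopen
  exact AddSubgroup.finiteIndex_of_finite_quotient

/-! ## §5  (N): the invariant functional is supported on the null cone -/

/-- **V2 (N) — NULL-CONE SUPPORT.**  `F` non-archimedean local, `ψ` of conductor exponent `m`, `q : X → F^ι` continuous; `V` a space of
functions on `X` (`coe` injective) with multiplication operators `M η` by the characters `x ↦ ψ(η ⬝ᵥ q x)`; `T : V →ₗ[ℂ] ℂ` with
`T (M η Φ) = T Φ` for all `η`.  If `coe Φ` is locally constant, compactly supported and `q ≠ 0` on its support, then **`T Φ = 0`**.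
[BernsteinZelevinsky1976, §1.1–1.5; KudlaRallis1990, §2] -/
theorem nullCone_support {ψ : AddChar F Circle} {m : ℤ} (hm : ψ.HasConductorExp m) {q : X → ι → F} (hq : Continuous q)
    {V : Type*} [AddCommGroup V] [Module ℂ V] (coe : V →ₗ[ℂ] (X → ℂ)) (hcoe : Function.Injective coe)
    (M : (ι → F) → V →ₗ[ℂ] V) (hM : ∀ (η : ι → F) (Φ : V) (x : X), coe (M η Φ) x = ((ψ (η ⬝ᵥ q x) : Circle) : ℂ) * coe Φ x)
    (T : V →ₗ[ℂ] ℂ) (hT : ∀ (η : ι → F) (Φ : V), T (M η Φ) = T Φ)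
    (Φ : V) (hΦl : IsLocallyConstant (coe Φ)) (hΦc : HasCompactSupport (coe Φ)) (h0 : ∀ x : X, coe Φ x ≠ 0 → q x ≠ 0) :
    T Φ = 0 := by
  obtain ⟨N', hN'⟩ := exists_small_lattice hm hq hΦc
  obtain ⟨N, hN⟩ := exists_large_lattice hm hq hΦl hΦc h0
  -- the two lattices `L′ = (𝔭^{N′})^ι ≤ L = (𝔭^{N₀})^ι`, `N₀ = min N N′`
  set N₀ : ℤ := min N N' with hN₀
  let L : AddSubgroup (ι → F) :=
    { carrier := piPrimePowBall F ι N₀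
      add_mem' := fun ha hb => add_mem_piPrimePowBall ha hb
      zero_mem' := zero_mem_piPrimePowBall N₀
      neg_mem' := fun ha => neg_mem_piPrimePowBall ha }
  let L' : AddSubgroup (ι → F) :=
    { carrier := piPrimePowBall F ι N'
      add_mem' := fun ha hb => add_mem_piPrimePowBall ha hb
      zero_mem' := zero_mem_piPrimePowBall N'
      neg_mem' := fun ha => neg_mem_piPrimePowBall ha }
  have hle : L' ≤ L := fun η hη => piPrimePowBall_antitone (min_le_right N N') hη
  haveI : (L'.addSubgroupOf L).FiniteIndex := finiteIndex_of_carrier_eq (L := L) (L' := L') rfl rfl hle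
  -- the characters
  refine apply_eq_zero_of_invariant coe hcoe (fun η x => ((ψ (η ⬝ᵥ q x) : Circle) : ℂ)) M hM hle ?_ ?_ T
    (fun η _ Φ => hT η Φ) Φ ?_ ?_
  · intro b _ b' _ x
    rw [add_dotProduct, AddChar.map_add_eq_mul, Circle.coe_mul]
  · intro x
    rw [zero_dotProduct, AddChar.map_zero_eq_one, Circle.coe_one]
  · intro x hx b' hb'
    rw [hN' b' hb' x hx, Circle.coe_one]
  · intro x hx
    obtain ⟨η, hη, hne⟩ := hN x hx
    refine ⟨η, piPrimePowBall_antitone (min_le_left N N') hη, fun h => hne ?_⟩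
    rwa [← Circle.coe_one, Circle.coe_inj] at h

/-- **(N) ON THE SCHWARTZ–BRUHAT SPACE `𝒮(X)`** (`V = SchwartzBruhat X ≤ (X → ℂ)`, multiplication operators as endomorphisms of `𝒮(X)`).
[BernsteinZelevinsky1976, §1.1–1.5] -/
theorem nullCone_support_schwartzBruhat {ψ : AddChar F Circle} {m : ℤ} (hm : ψ.HasConductorExp m) {q : X → ι → F} (hq : Continuous q)
    (M : (ι → F) → SchwartzBruhat X →ₗ[ℂ] SchwartzBruhat X)
    (hM : ∀ (η : ι → F) (Φ : SchwartzBruhat X) (x : X), (M η Φ : X → ℂ) x = ((ψ (η ⬝ᵥ q x) : Circle) : ℂ) * (Φ : X → ℂ) x)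
    (T : SchwartzBruhat X →ₗ[ℂ] ℂ) (hT : ∀ (η : ι → F) (Φ : SchwartzBruhat X), T (M η Φ) = T Φ)
    (Φ : SchwartzBruhat X) (h0 : ∀ x : X, (Φ : X → ℂ) x ≠ 0 → q x ≠ 0) :
    T Φ = 0 :=
  nullCone_support hm hq (SchwartzBruhat X).subtype (SchwartzBruhat X).injective_subtype M hM T hT Φ Φ.2.1 Φ.2.2 h0

/-- **(N′)**: if `coe Φ` VANISHES ON THE NULL CONE `{q = 0}` (locally constant and compactly supported), then `T Φ = 0`.
[BernsteinZelevinsky1976, §1.5] -/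
theorem apply_eq_zero_of_eqOn_nullCone {ψ : AddChar F Circle} {m : ℤ} (hm : ψ.HasConductorExp m) {q : X → ι → F}
    (hq : Continuous q) {V : Type*} [AddCommGroup V] [Module ℂ V] (coe : V →ₗ[ℂ] (X → ℂ)) (hcoe : Function.Injective coe)
    (M : (ι → F) → V →ₗ[ℂ] V) (hM : ∀ (η : ι → F) (Φ : V) (x : X), coe (M η Φ) x = ((ψ (η ⬝ᵥ q x) : Circle) : ℂ) * coe Φ x)
    (T : V →ₗ[ℂ] ℂ) (hT : ∀ (η : ι → F) (Φ : V), T (M η Φ) = T Φ)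
    (Φ : V) (hΦl : IsLocallyConstant (coe Φ)) (hΦc : HasCompactSupport (coe Φ)) (hvan : ∀ x : X, q x = 0 → coe Φ x = 0) :
    T Φ = 0 :=
  nullCone_support hm hq coe hcoe M hM T hT Φ hΦl hΦc fun x hx hqx => hx (hvan x hqx)

/-- **TWO FUNCTIONALS AGREEING OFF... — the difference form**: if `coe Φ` and `coe Φ′` agree on the null cone (both locally constant,
compactly supported) then `T Φ = T Φ′` — `T` FACTORS THROUGH THE RESTRICTION TO `{q = 0}`. [BernsteinZelevinsky1976, §1.5] -/
theorem apply_eq_of_eqOn_nullCone {ψ : AddChar F Circle} {m : ℤ} (hm : ψ.HasConductorExp m) {q : X → ι → F}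
    (hq : Continuous q) {V : Type*} [AddCommGroup V] [Module ℂ V] (coe : V →ₗ[ℂ] (X → ℂ)) (hcoe : Function.Injective coe)
    (M : (ι → F) → V →ₗ[ℂ] V) (hM : ∀ (η : ι → F) (Φ : V) (x : X), coe (M η Φ) x = ((ψ (η ⬝ᵥ q x) : Circle) : ℂ) * coe Φ x)
    (T : V →ₗ[ℂ] ℂ) (hT : ∀ (η : ι → F) (Φ : V), T (M η Φ) = T Φ)
    (Φ Φ' : V) (hΦl : IsLocallyConstant (coe Φ)) (hΦc : HasCompactSupport (coe Φ))
    (hΦ'l : IsLocallyConstant (coe Φ')) (hΦ'c : HasCompactSupport (coe Φ'))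
    (hagree : ∀ x : X, q x = 0 → coe Φ x = coe Φ' x) :
    T Φ = T Φ' := by
  have h : T (Φ - Φ') = 0 := by
    refine apply_eq_zero_of_eqOn_nullCone hm hq coe hcoe M hM T hT (Φ - Φ') ?_ ?_ fun x hx => ?_
    · rw [map_sub]
      exact hΦl.sub hΦ'l
    · rw [map_sub]
      exact hΦc.sub hΦ'c
    · rw [map_sub, Pi.sub_apply, hagree x hx, sub_self]
  rwa [map_sub, sub_eq_zero] at h

/-! ## §6  The consumer's currency (K2Liu-p09 (g6) (q1)(q2) 11:27:21Z): `T : (X → ℂ) →ₗ[ℂ] ℂ`, hypotheses on `𝒮(X)` only,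
`ψ` continuous non-trivial -/

/-- The character `x ↦ ψ(η ⬝ᵥ q x)` (as a `ℂ`-valued function) is LOCALLY CONSTANT (`ψ` has a conductor, `q` is continuous).
[BernsteinZelevinsky1976, §1.1] -/
theorem isLocallyConstant_addChar_dotProduct {ψ : AddChar F Circle} (hψ : ψ.IsContinuousNontrivial) {q : X → ι → F}
    (hq : Continuous q) (η : ι → F) : IsLocallyConstant fun x => ((ψ (η ⬝ᵥ q x) : Circle) : ℂ) :=
  (((Literature.RepresentationTheory.HeisenbergGroup.isLocallyConstant_of_isContinuousNontrivial hψ).comp_continuous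
    (continuous_const.dotProduct hq)).comp _ : _)

/-- Multiplication by the character preserves `𝒮(X)`. [BernsteinZelevinsky1976, §1.1] -/
theorem addChar_dotProduct_mul_mem_schwartzBruhat {ψ : AddChar F Circle} (hψ : ψ.IsContinuousNontrivial) {q : X → ι → F}
    (hq : Continuous q) (η : ι → F) {Φ : X → ℂ} (hΦl : IsLocallyConstant Φ) (hΦc : HasCompactSupport Φ) :
    (fun x => ((ψ (η ⬝ᵥ q x) : Circle) : ℂ) * Φ x) ∈ SchwartzBruhat X :=
  ⟨(isLocallyConstant_addChar_dotProduct hψ hq η).mul hΦl, hΦc.mul_left⟩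

/-- **V2 (N) IN THE CONSUMER'S CURRENCY.**  `ψ` a continuous non-trivial additive character of the non-archimedean local field `F`,
`q : X → F^ι` continuous, `T : (X → ℂ) →ₗ[ℂ] ℂ` ANY linear functional such that `T(ψ(η ⬝ᵥ q ·) · Φ) = T Φ` for all `η : F^ι` and all
`Φ ∈ 𝒮(X)` (locally constant, compactly supported).  Then `T Φ = 0` for every `Φ ∈ 𝒮(X)` supported off the null cone `{q = 0}`.
[BernsteinZelevinsky1976, §1.1–1.5; KudlaRallis1990, §2] -/
theorem nullCone_support_fun {ψ : AddChar F Circle} (hψ : ψ.IsContinuousNontrivial) {q : X → ι → F} (hq : Continuous q)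
    (T : (X → ℂ) →ₗ[ℂ] ℂ)
    (hT : ∀ (η : ι → F) (Φ : X → ℂ), IsLocallyConstant Φ → HasCompactSupport Φ →
      T (fun x => ((ψ (η ⬝ᵥ q x) : Circle) : ℂ) * Φ x) = T Φ)
    (Φ : X → ℂ) (hΦl : IsLocallyConstant Φ) (hΦc : HasCompactSupport Φ) (h0 : ∀ x : X, Φ x ≠ 0 → q x ≠ 0) :
    T Φ = 0 := by
  obtain ⟨m, hm⟩ := hψ.exists_hasConductorExp
  -- multiplication by the characters as endomorphisms of `𝒮(X)`
  let M : (ι → F) → SchwartzBruhat X →ₗ[ℂ] SchwartzBruhat X := fun η =>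
    { toFun := fun Φ => ⟨fun x => ((ψ (η ⬝ᵥ q x) : Circle) : ℂ) * (Φ : X → ℂ) x,
        addChar_dotProduct_mul_mem_schwartzBruhat hψ hq η Φ.2.1 Φ.2.2⟩
      map_add' := fun Φ Φ' => by
        ext x
        simp only [Submodule.coe_add, Pi.add_apply, mul_add]
      map_smul' := fun c Φ => by
        ext x
        simp only [Submodule.coe_smul, Pi.smul_apply, smul_eq_mul, RingHom.id_apply, mul_left_comm] }
  have h := nullCone_support hm hq (SchwartzBruhat X).subtype (SchwartzBruhat X).injective_subtype M (fun η Φ x => rfl)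
    (T ∘ₗ (SchwartzBruhat X).subtype) (fun η Φ => hT η Φ Φ.2.1 Φ.2.2) ⟨Φ, hΦl, hΦc⟩ hΦl hΦc h0
  simpa using h

/-- **(N′) IN THE CONSUMER'S CURRENCY**: `Φ ∈ 𝒮(X)` vanishing on `{q = 0}` has `T Φ = 0`. [BernsteinZelevinsky1976, §1.5] -/
theorem apply_eq_zero_of_eqOn_nullCone_fun {ψ : AddChar F Circle} (hψ : ψ.IsContinuousNontrivial) {q : X → ι → F}
    (hq : Continuous q) (T : (X → ℂ) →ₗ[ℂ] ℂ)
    (hT : ∀ (η : ι → F) (Φ : X → ℂ), IsLocallyConstant Φ → HasCompactSupport Φ →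
      T (fun x => ((ψ (η ⬝ᵥ q x) : Circle) : ℂ) * Φ x) = T Φ)
    (Φ : X → ℂ) (hΦl : IsLocallyConstant Φ) (hΦc : HasCompactSupport Φ) (hvan : ∀ x : X, q x = 0 → Φ x = 0) :
    T Φ = 0 :=
  nullCone_support_fun hψ hq T hT Φ hΦl hΦc fun x hx hqx => hx (hvan x hqx)

/-- **`T` FACTORS THROUGH RESTRICTION TO THE NULL CONE (consumer's currency)**: two elements of `𝒮(X)` that agree on `{q = 0}` have the
same `T`-value — so `f ↦ T(Φ_f)` is well defined on restrictions `f = Φ|_{𝒩}` (V5's construction, with V2c supplying `Φ_f`).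
[BernsteinZelevinsky1976, §1.5] -/
theorem apply_eq_of_eqOn_nullCone_fun {ψ : AddChar F Circle} (hψ : ψ.IsContinuousNontrivial) {q : X → ι → F}
    (hq : Continuous q) (T : (X → ℂ) →ₗ[ℂ] ℂ)
    (hT : ∀ (η : ι → F) (Φ : X → ℂ), IsLocallyConstant Φ → HasCompactSupport Φ →
      T (fun x => ((ψ (η ⬝ᵥ q x) : Circle) : ℂ) * Φ x) = T Φ)
    (Φ Φ' : X → ℂ) (hΦl : IsLocallyConstant Φ) (hΦc : HasCompactSupport Φ) (hΦ'l : IsLocallyConstant Φ')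
    (hΦ'c : HasCompactSupport Φ') (hagree : ∀ x : X, q x = 0 → Φ x = Φ' x) :
    T Φ = T Φ' := by
  have h : T (Φ - Φ') = 0 :=
    apply_eq_zero_of_eqOn_nullCone_fun hψ hq T hT (Φ - Φ') (hΦl.sub hΦ'l) (hΦc.sub hΦ'c) fun x hx => by
      rw [Pi.sub_apply, hagree x hx, sub_self]
  rwa [map_sub, sub_eq_zero] at h

end Summit.HodgeConjecture.HodgeConjecture.Cruxes.HLiu418.K2LiuNullConeSupport

end
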